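import Summits.Parity.GeneralizedHardyLittlewood.Theorems.BeyondDiagonalBeatsQuarter.OffDiagDualBoxSize
import Summits.Parity.GeneralizedHardyLittlewood.Theorems.BeyondDiagonalBeatsQuarter.OffDiagDualCostBessel
import Mathlib.Analysis.Calculus.MeanValue
import HarnessLib

/-!
# Route `PrimeLevelFamEdge`, crux K_B (stmt-Parity-20343), line `diagonal_kernel_split` rev 4, plan Ω,
# a8P closable principal piece (input I1 of `OffDiagPrincipalClosableTotal`) — **u-REGULARITY of the box weight:
# the product `u = αβ` of the Kloosterman frequencies made a REAL parameter, with a uniform sup bound and a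
# uniform Lipschitz bound in `u` for the box weight and for its `t₁`-transform (the sample weight of a8P)**

C1 with a phase (`MellinBumpPhase.mellinBump_xsq_cos/_sin`, `OffDiagPrincipalShortBound.mellinBump_xsq_e`) is applied
to the `(l,m)`-sums `Σ c_l c_m·F(lm/(d₁d₂))` of the principal samples, where `F(u) = 𝓕(t₁ ↦ Φ_{q,d,u,c,i}(t₁, y₂))(ξ)`
and the box weight depends on `(α, β) = (l/d₁, m/d₂)` only through `u = αβ` inside `J₁(4π√(u·t₁t₂)/(qc))`
(`OffDiag.layerWeightR`). C1 wants a real function `h(y) = ρ(y)·√(Yy)·F(Yy)` with explicit sup `B` and Lipschitz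
constant `K`; this file supplies the `u`-uniform data of `F`:

* `boxWeightU q d₁ d₂ u c i` (definition, reviewed) — the box weight with `√(α t₁·β t₂)` replaced by `√(u·t₁·t₂)`,
  `u : ℝ`; `boxWeightU_natCast_mul` (`u = αβ` recovers `boxWeight`), `boxWeightU_eq_zero_of_not_mem`,
  `contDiff_uncurry_boxWeightU`, `hasCompactSupport_uncurry_boxWeightU`, `boxWeightU_height` (`u > 0`: the hypotheses
  of `OffDiagPrincipalCoprime`/`…Short` for `Φ := boxWeightU … u …`);
* `abs_prefactor_le`, `abs_prefactor_mul_sqrt_le` — the Bessel-free prefactor `P(t) = ((d₁t₁)(d₂t₂))^{−1/2}·W(·)·c⁻¹`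
  on the box: `|P| ≤ S₀ := (d₁d₂K₁K₂/4)^{−1/2}·W(X/4)·c⁻¹`, `|P|·√(t₁t₂) ≤ S₁ := (d₁d₂)^{−1/2}·W(X/4)·c⁻¹`
  (`X/4 = d₁d₂K₁K₂/(4q̂²)`, `K_j = 2^{i_j}`);
* **`norm_boxWeightU_le`** — `‖boxWeightU u t₁ t₂‖ ≤ S₀` for ALL `u, t` (`|J₁| ≤ 1`);
* `abs_besselJ_one_sub_le`, `abs_sqrt_sub_sqrt_le_of_le` — `|J₁(z) − J₁(z′)| ≤ |z − z′|` (`|J₁′| ≤ 1`),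
  `|√u − √u′| ≤ |u − u′|/(2√u₀)` on `u, u′ ≥ u₀ > 0`;
* **`norm_boxWeightU_sub_le`** — `‖boxWeightU u t − boxWeightU u′ t‖ ≤ (2π·S₁/(q·c·√u₀))·|u − u′|` for
  `u, u′ ≥ u₀ > 0`, all `t`;
* the bounds for the `t₁`-TRANSFORM `F(u) = 𝓕(t₁ ↦ boxWeightU u t₁ y₂)(ξ)` (`‖F u‖ ≤ 4(K₁+K₂)·S₀`,
  `‖F u − F u′‖ ≤ 4(K₁+K₂)·(2π·S₁/(q·c·√u₀))·|u − u′|`) are the companion file `OffDiagBoxTransformLipschitz`.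

Crude constants on purpose. Absolute values only; nothing about the heart. Helper toward `stub_offDiagBelowSlack_io`
(`--supports stmt-Parity-20343`); standard axioms.
«The programme SEARCHES and TYPES; no claim about Landau–Siegel zeros, Theorems 1–2 of arXiv:2211.02515 or
a repaired Margin232 until a kernel theorem says so.»
-/

noncomputable section

open Set MeasureTheory
open scoped Real FourierTransform ContDiff

namespace Summit.Parity.GeneralizedHardyLittlewood.Theorems.BeyondDiagonalBeatsQuarter.OffDiag

open Literature.NumberTheory.LFunctions Literature.NumberTheory.LFunctions.KMV2000
open Literature.Analysis.FunctionSpaces (besselJ abs_besselJ_one_le_one differentiable_besselJ)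
open Literature.Analysis.Calculus.WhitneyConvex (dyadicBump dyadicBump_nonneg dyadicBump_le_one)
open Literature.NumberTheory.Sieve.FriedlanderIwaniecPrimes (BoxSupport fourier_eq_integral_ker ker norm_ker)

variable {q d₁ d₂ c : ℕ}

/-! ### §1. The box weight with a real frequency product -/

/-- **The box weight with `u = αβ` a real parameter**: `Φ_{i,u}(y₁,y₂) = θ(y₁/2^{i₁})θ(y₂/2^{i₂})·
((d₁y₁)(d₂y₂))^{−1/2}·W((d₁y₁)(d₂y₂)/q̂²)·c⁻¹·J₁(4π√(u·y₁·y₂)/(qc))` (for `u = (l/d₁)(m/d₂)` this is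
`OffDiag.boxWeight`, `boxWeightU_natCast_mul`). [cite: KowalskiMichelVanderKam2000, (21)–(23) p. 12 — derivation] -/
def boxWeightU (q d₁ d₂ : ℕ) (u : ℝ) (c : ℕ) (i : ℕ × ℕ) (y₁ y₂ : ℝ) : ℂ :=
  ((dyadicBump (y₁ / 2 ^ i.1) * dyadicBump (y₂ / 2 ^ i.2) : ℝ) : ℂ) *
    ((((d₁ : ℝ) * y₁ * ((d₂ : ℝ) * y₂)) ^ (-(1 / 2 : ℝ)) *
        cutoffW ((d₁ : ℝ) * y₁ * ((d₂ : ℝ) * y₂) / qhat q ^ 2) * (c : ℝ)⁻¹ *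
      besselJ 1 (4 * π * Real.sqrt (u * y₁ * (1 * y₂)) / ((q : ℝ) * c)) : ℝ) : ℂ)

/-- At `u = αβ` the real-parameter box weight is the box weight of Ω-d5. [folklore] -/
theorem boxWeightU_natCast_mul (α β : ℕ) (i : ℕ × ℕ) :
    boxWeightU q d₁ d₂ ((α : ℝ) * β) c i = boxWeight q d₁ d₂ α β c i := by
  funext y₁ y₂
  simp only [boxWeightU, boxWeight, layerWeightR]
  rw [show (α : ℝ) * β * y₁ * (1 * y₂) = (α : ℝ) * y₁ * ((β : ℝ) * y₂) by ring]

/-- Off the box `[2^{i₁}/2, 2·2^{i₁}] × [2^{i₂}/2, 2·2^{i₂}]` the weight vanishes. [folklore] -/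
theorem boxWeightU_eq_zero_of_not_mem (u : ℝ) {i : ℕ × ℕ} {t₁ t₂ : ℝ}
    (h : ¬ (t₁ ∈ Icc ((2 : ℝ) ^ i.1 / 2) (2 * 2 ^ i.1) ∧ t₂ ∈ Icc ((2 : ℝ) ^ i.2 / 2) (2 * 2 ^ i.2))) :
    boxWeightU q d₁ d₂ u c i t₁ t₂ = 0 := by
  by_contra hne
  have hθ : dyadicBump (t₁ / 2 ^ i.1) * dyadicBump (t₂ / 2 ^ i.2) ≠ 0 := by
    intro h0; exact hne (by rw [boxWeightU, h0, Complex.ofReal_zero, zero_mul])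
  obtain ⟨⟨a1, a2⟩, ⟨b1, b2⟩⟩ := mem_box_of_bump₂_ne_zero hθ
  exact h ⟨⟨a1.le, a2.le⟩, ⟨b1.le, b2.le⟩⟩

/-- If the weight is non-zero the point is in the open box. [folklore] -/
theorem mem_box_of_boxWeightU_ne_zero {u : ℝ} {i : ℕ × ℕ} {t₁ t₂ : ℝ}
    (h : boxWeightU q d₁ d₂ u c i t₁ t₂ ≠ 0) :
    ((2 : ℝ) ^ i.1 / 2 < t₁ ∧ t₁ < 2 * 2 ^ i.1) ∧ ((2 : ℝ) ^ i.2 / 2 < t₂ ∧ t₂ < 2 * 2 ^ i.2) := by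
  have hθ : dyadicBump (t₁ / 2 ^ i.1) * dyadicBump (t₂ / 2 ^ i.2) ≠ 0 := by
    intro h0; exact h (by rw [boxWeightU, h0, Complex.ofReal_zero, zero_mul])
  exact mem_box_of_bump₂_ne_zero hθ

/-- Height support: `Φ_{i,u}(t₁,t₂) ≠ 0 ⇒ 2^{i₂}/2 < t₂ < 2^{i₂+1}` (the hypothesis shape of `OffDiagPrincipalShort`/`…Coprime`).
[folklore] -/
theorem boxWeightU_height (u : ℝ) (i : ℕ × ℕ) :
    ∀ t₁ t₂ : ℝ, boxWeightU q d₁ d₂ u c i t₁ t₂ ≠ 0 → (2 : ℝ) ^ i.2 / 2 < t₂ ∧ t₂ < 2 ^ (i.2 + 1) := by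
  intro t₁ t₂ h
  obtain ⟨-, b1, b2⟩ := mem_box_of_boxWeightU_ne_zero h
  exact ⟨b1, by rw [pow_succ]; linarith⟩

/-- **`Φ_{i,u}` is smooth on `ℝ²`** for `q, d₁, d₂ ≥ 1` and `u > 0`. [folklore] -/
theorem contDiff_uncurry_boxWeightU [NeZero q] (hd₁ : 1 ≤ d₁) (hd₂ : 1 ≤ d₂) {u : ℝ} (hu : 0 < u)
    (i : ℕ × ℕ) : ContDiff ℝ ∞ (Function.uncurry (boxWeightU q d₁ d₂ u c i)) := by
  have hg := contDiffOn_layerWeight (d₁ := (d₁ : ℝ)) (d₂ := (d₂ : ℝ)) (by exact_mod_cast hd₁)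
    (by exact_mod_cast hd₂) (qhat_pos_of_neZero q) hu one_pos ((c : ℝ)⁻¹) ((q : ℝ) * c)
  have h := contDiff_dyadicBox_mul (by positivity : (0 : ℝ) < 2 ^ i.1) (by positivity : (0 : ℝ) < 2 ^ i.2) hg
  have heq : Function.uncurry (boxWeightU q d₁ d₂ u c i) = fun y : ℝ × ℝ ↦
      ((dyadicBump (y.1 / 2 ^ i.1) * dyadicBump (y.2 / 2 ^ i.2) : ℝ) : ℂ) *
        ((((d₁ : ℝ) * y.1 * ((d₂ : ℝ) * y.2)) ^ (-(1 / 2 : ℝ)) *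
            cutoffW ((d₁ : ℝ) * y.1 * ((d₂ : ℝ) * y.2) / qhat q ^ 2) * (c : ℝ)⁻¹ *
          besselJ 1 (4 * π * Real.sqrt (u * y.1 * (1 * y.2)) / ((q : ℝ) * c)) : ℝ) : ℂ) := by
    funext y; rfl
  rw [heq]
  exact h

/-- **`Φ_{i,u}` has compact support.** [folklore] -/
theorem hasCompactSupport_uncurry_boxWeightU (u : ℝ) (i : ℕ × ℕ) :
    HasCompactSupport (Function.uncurry (boxWeightU q d₁ d₂ u c i)) := by
  have h := hasCompactSupport_dyadicBox_mul (by positivity : (0 : ℝ) < 2 ^ i.1)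
    (by positivity : (0 : ℝ) < 2 ^ i.2)
    (fun y : ℝ × ℝ ↦ ((((d₁ : ℝ) * y.1 * ((d₂ : ℝ) * y.2)) ^ (-(1 / 2 : ℝ)) *
        cutoffW ((d₁ : ℝ) * y.1 * ((d₂ : ℝ) * y.2) / qhat q ^ 2) * (c : ℝ)⁻¹ *
      besselJ 1 (4 * π * Real.sqrt (u * y.1 * (1 * y.2)) / ((q : ℝ) * c)) : ℝ) : ℂ))
  have heq : Function.uncurry (boxWeightU q d₁ d₂ u c i) = fun y : ℝ × ℝ ↦
      ((dyadicBump (y.1 / 2 ^ i.1) * dyadicBump (y.2 / 2 ^ i.2) : ℝ) : ℂ) *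
        ((((d₁ : ℝ) * y.1 * ((d₂ : ℝ) * y.2)) ^ (-(1 / 2 : ℝ)) *
            cutoffW ((d₁ : ℝ) * y.1 * ((d₂ : ℝ) * y.2) / qhat q ^ 2) * (c : ℝ)⁻¹ *
          besselJ 1 (4 * π * Real.sqrt (u * y.1 * (1 * y.2)) / ((q : ℝ) * c)) : ℝ) : ℂ) := by
    funext y; rfl
  rw [heq]
  exact h

/-- Box support in the FI sense (radius `2(2^{i₁} + 2^{i₂})`). [folklore] -/
theorem boxSupport_boxWeightU (u : ℝ) (i : ℕ × ℕ) :
    BoxSupport (boxWeightU q d₁ d₂ u c i) (2 * ((2 : ℝ) ^ i.1 + 2 ^ i.2)) := by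
  intro t₁ t₂ hne
  obtain ⟨⟨a1, a2⟩, ⟨b1, b2⟩⟩ := mem_box_of_boxWeightU_ne_zero hne
  have h1 : (0 : ℝ) < 2 ^ i.1 := by positivity
  have h2 : (0 : ℝ) < 2 ^ i.2 := by positivity
  constructor
  · rw [abs_le]; constructor <;> linarith
  · rw [abs_le]; constructor <;> linarith

/-! ### §2. The Bessel-free prefactor on the box -/

/-- **The prefactor on the box.** For `d₁, d₂ ≥ 1`, `K₁, K₂ > 0` and `t₁ > K₁/2`, `t₂ > K₂/2`:
`|((d₁t₁)(d₂t₂))^{−1/2}·W((d₁t₁)(d₂t₂)/q̂²)·c⁻¹| ≤ (d₁d₂K₁K₂/4)^{−1/2}·W(d₁d₂K₁K₂/(4q̂²))·c⁻¹` (both `(·)^{−1/2}`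
and `W` are antitone). [cite: KowalskiMichelVanderKam2000, (21)–(22) p. 12 — derivation] -/
theorem abs_prefactor_le [NeZero q] (hd₁ : 1 ≤ d₁) (hd₂ : 1 ≤ d₂) {K₁ K₂ : ℝ} (hK₁ : 0 < K₁) (hK₂ : 0 < K₂)
    {t₁ t₂ : ℝ} (ht₁ : K₁ / 2 < t₁) (ht₂ : K₂ / 2 < t₂) :
    |((d₁ : ℝ) * t₁ * ((d₂ : ℝ) * t₂)) ^ (-(1 / 2 : ℝ)) *
        cutoffW ((d₁ : ℝ) * t₁ * ((d₂ : ℝ) * t₂) / qhat q ^ 2) * (c : ℝ)⁻¹| ≤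
      ((d₁ : ℝ) * d₂ * (K₁ * K₂) / 4) ^ (-(1 / 2 : ℝ)) * cutoffW ((d₁ : ℝ) * d₂ * (K₁ * K₂) / 4 / qhat q ^ 2) *
        (c : ℝ)⁻¹ := by
  have hQ : 0 < qhat q := qhat_pos_of_neZero q
  have hd₁0 : (0 : ℝ) < d₁ := by exact_mod_cast hd₁
  have hd₂0 : (0 : ℝ) < d₂ := by exact_mod_cast hd₂
  have ht1 : 0 < t₁ := lt_trans (by positivity) ht₁
  have ht2 : 0 < t₂ := lt_trans (by positivity) ht₂
  set P : ℝ := (d₁ : ℝ) * t₁ * ((d₂ : ℝ) * t₂) with hP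
  have hP0 : 0 < P := by positivity
  have hB0 : 0 < (d₁ : ℝ) * d₂ * (K₁ * K₂) / 4 := by positivity
  have hPB : (d₁ : ℝ) * d₂ * (K₁ * K₂) / 4 ≤ P := by
    have h12 : K₁ / 2 * (K₂ / 2) ≤ t₁ * t₂ := mul_le_mul ht₁.le ht₂.le (by positivity) ht1.le
    calc (d₁ : ℝ) * d₂ * (K₁ * K₂) / 4 = (d₁ : ℝ) * d₂ * (K₁ / 2 * (K₂ / 2)) := by ring
      _ ≤ (d₁ : ℝ) * d₂ * (t₁ * t₂) := mul_le_mul_of_nonneg_left h12 (by positivity)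
      _ = P := by rw [hP]; ring
  have h1 : P ^ (-(1 / 2 : ℝ)) ≤ ((d₁ : ℝ) * d₂ * (K₁ * K₂) / 4) ^ (-(1 / 2 : ℝ)) :=
    Real.rpow_le_rpow_of_nonpos hB0 hPB (by norm_num)
  have h2 : cutoffW (P / qhat q ^ 2) ≤ cutoffW ((d₁ : ℝ) * d₂ * (K₁ * K₂) / 4 / qhat q ^ 2) :=
    cutoffW_antitoneOn (show (0 : ℝ) ≤ _ by positivity) (show (0 : ℝ) ≤ P / qhat q ^ 2 by positivity)
      (div_le_div_of_nonneg_right hPB (by positivity))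
  have hW0 : 0 ≤ cutoffW (P / qhat q ^ 2) := cutoffW_nonneg _
  have hr0 : 0 ≤ (c : ℝ)⁻¹ := by positivity
  rw [abs_of_nonneg (by positivity)]
  exact mul_le_mul (mul_le_mul h1 h2 hW0 (le_of_lt (Real.rpow_pos_of_pos hB0 _))) le_rfl hr0
    (by have := cutoffW_nonneg ((d₁ : ℝ) * d₂ * (K₁ * K₂) / 4 / qhat q ^ 2); positivity)

/-- **The prefactor times `√(t₁t₂)` on the box**: `|P(t)|·√(t₁t₂) ≤ (d₁d₂)^{−1/2}·W(d₁d₂K₁K₂/(4q̂²))·c⁻¹`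
(the `(t₁t₂)^{−1/2}` cancels). [cite: KowalskiMichelVanderKam2000, (21)–(22) p. 12 — derivation] -/
theorem abs_prefactor_mul_sqrt_le [NeZero q] (hd₁ : 1 ≤ d₁) (hd₂ : 1 ≤ d₂) {K₁ K₂ : ℝ} (hK₁ : 0 < K₁)
    (hK₂ : 0 < K₂) {t₁ t₂ : ℝ} (ht₁ : K₁ / 2 < t₁) (ht₂ : K₂ / 2 < t₂) :
    |((d₁ : ℝ) * t₁ * ((d₂ : ℝ) * t₂)) ^ (-(1 / 2 : ℝ)) *
        cutoffW ((d₁ : ℝ) * t₁ * ((d₂ : ℝ) * t₂) / qhat q ^ 2) * (c : ℝ)⁻¹| * Real.sqrt (t₁ * t₂) ≤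
      ((d₁ : ℝ) * d₂) ^ (-(1 / 2 : ℝ)) * cutoffW ((d₁ : ℝ) * d₂ * (K₁ * K₂) / 4 / qhat q ^ 2) * (c : ℝ)⁻¹ := by
  have hQ : 0 < qhat q := qhat_pos_of_neZero q
  have hd₁0 : (0 : ℝ) < d₁ := by exact_mod_cast hd₁
  have hd₂0 : (0 : ℝ) < d₂ := by exact_mod_cast hd₂
  have ht1 : 0 < t₁ := lt_trans (by positivity) ht₁
  have ht2 : 0 < t₂ := lt_trans (by positivity) ht₂
  have hD0 : 0 < (d₁ : ℝ) * d₂ := by positivity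
  have hT0 : 0 < t₁ * t₂ := by positivity
  -- split the power: `((d₁t₁)(d₂t₂))^{−1/2} = (d₁d₂)^{−1/2}·(t₁t₂)^{−1/2}` and `(t₁t₂)^{−1/2}√(t₁t₂) = 1`
  have hsplit : ((d₁ : ℝ) * t₁ * ((d₂ : ℝ) * t₂)) ^ (-(1 / 2 : ℝ)) =
      ((d₁ : ℝ) * d₂) ^ (-(1 / 2 : ℝ)) * (t₁ * t₂) ^ (-(1 / 2 : ℝ)) := by
    rw [show (d₁ : ℝ) * t₁ * ((d₂ : ℝ) * t₂) = ((d₁ : ℝ) * d₂) * (t₁ * t₂) by ring]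
    exact Real.mul_rpow hD0.le hT0.le
  have hcancel : (t₁ * t₂) ^ (-(1 / 2 : ℝ)) * Real.sqrt (t₁ * t₂) = 1 := by
    rw [Real.sqrt_eq_rpow, ← Real.rpow_add hT0]
    norm_num
  have hWle : cutoffW ((d₁ : ℝ) * t₁ * ((d₂ : ℝ) * t₂) / qhat q ^ 2) ≤
      cutoffW ((d₁ : ℝ) * d₂ * (K₁ * K₂) / 4 / qhat q ^ 2) := by
    have hPB : (d₁ : ℝ) * d₂ * (K₁ * K₂) / 4 ≤ (d₁ : ℝ) * t₁ * ((d₂ : ℝ) * t₂) := by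
      have h12 : K₁ / 2 * (K₂ / 2) ≤ t₁ * t₂ := mul_le_mul ht₁.le ht₂.le (by positivity) ht1.le
      calc (d₁ : ℝ) * d₂ * (K₁ * K₂) / 4 = (d₁ : ℝ) * d₂ * (K₁ / 2 * (K₂ / 2)) := by ring
        _ ≤ (d₁ : ℝ) * d₂ * (t₁ * t₂) := mul_le_mul_of_nonneg_left h12 (by positivity)
        _ = _ := by ring
    exact cutoffW_antitoneOn (show (0 : ℝ) ≤ _ by positivity) (show (0 : ℝ) ≤ _ by positivity)
      (div_le_div_of_nonneg_right hPB (by positivity))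
  have hW0 : 0 ≤ cutoffW ((d₁ : ℝ) * t₁ * ((d₂ : ℝ) * t₂) / qhat q ^ 2) := cutoffW_nonneg _
  rw [abs_of_nonneg (by positivity), hsplit]
  calc ((d₁ : ℝ) * d₂) ^ (-(1 / 2 : ℝ)) * (t₁ * t₂) ^ (-(1 / 2 : ℝ)) *
        cutoffW ((d₁ : ℝ) * t₁ * ((d₂ : ℝ) * t₂) / qhat q ^ 2) * (c : ℝ)⁻¹ * Real.sqrt (t₁ * t₂)
      = ((d₁ : ℝ) * d₂) ^ (-(1 / 2 : ℝ)) * cutoffW ((d₁ : ℝ) * t₁ * ((d₂ : ℝ) * t₂) / qhat q ^ 2) *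
          (c : ℝ)⁻¹ * ((t₁ * t₂) ^ (-(1 / 2 : ℝ)) * Real.sqrt (t₁ * t₂)) := by ring
    _ = ((d₁ : ℝ) * d₂) ^ (-(1 / 2 : ℝ)) * cutoffW ((d₁ : ℝ) * t₁ * ((d₂ : ℝ) * t₂) / qhat q ^ 2) *
          (c : ℝ)⁻¹ := by rw [hcancel, mul_one]
    _ ≤ ((d₁ : ℝ) * d₂) ^ (-(1 / 2 : ℝ)) * cutoffW ((d₁ : ℝ) * d₂ * (K₁ * K₂) / 4 / qhat q ^ 2) *
          (c : ℝ)⁻¹ := by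
        have hA0 : 0 ≤ ((d₁ : ℝ) * d₂) ^ (-(1 / 2 : ℝ)) := le_of_lt (Real.rpow_pos_of_pos hD0 _)
        have hc0 : 0 ≤ (c : ℝ)⁻¹ := by positivity
        exact mul_le_mul_of_nonneg_right (mul_le_mul_of_nonneg_left hWle hA0) hc0

/-! ### §3. Uniform sup and `u`-Lipschitz bounds of the box weight -/

/-- **Sup bound, uniform in `u`**: `‖Φ_{i,u}(t₁,t₂)‖ ≤ S₀ = (d₁d₂K₁K₂/4)^{−1/2}·W(d₁d₂K₁K₂/(4q̂²))·c⁻¹`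
(`K_j = 2^{i_j}`) for ALL `u, t₁, t₂` (`0 ≤ θθ ≤ 1`, `|J₁| ≤ 1`, `= 0` off the box). [folklore] -/
theorem norm_boxWeightU_le [NeZero q] (hd₁ : 1 ≤ d₁) (hd₂ : 1 ≤ d₂) (u : ℝ) (i : ℕ × ℕ) (t₁ t₂ : ℝ) :
    ‖boxWeightU q d₁ d₂ u c i t₁ t₂‖ ≤
      ((d₁ : ℝ) * d₂ * ((2 : ℝ) ^ i.1 * 2 ^ i.2) / 4) ^ (-(1 / 2 : ℝ)) *
        cutoffW ((d₁ : ℝ) * d₂ * ((2 : ℝ) ^ i.1 * 2 ^ i.2) / 4 / qhat q ^ 2) * (c : ℝ)⁻¹ := by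
  have hS0 : 0 ≤ ((d₁ : ℝ) * d₂ * ((2 : ℝ) ^ i.1 * 2 ^ i.2) / 4) ^ (-(1 / 2 : ℝ)) *
      cutoffW ((d₁ : ℝ) * d₂ * ((2 : ℝ) ^ i.1 * 2 ^ i.2) / 4 / qhat q ^ 2) * (c : ℝ)⁻¹ := by
    have := cutoffW_nonneg ((d₁ : ℝ) * d₂ * ((2 : ℝ) ^ i.1 * 2 ^ i.2) / 4 / qhat q ^ 2)
    positivity
  by_cases hθ : dyadicBump (t₁ / 2 ^ i.1) * dyadicBump (t₂ / 2 ^ i.2) = 0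
  · rw [boxWeightU, hθ, Complex.ofReal_zero, zero_mul, norm_zero]; exact hS0
  obtain ⟨⟨h1, -⟩, ⟨h2, -⟩⟩ := mem_box_of_bump₂_ne_zero hθ
  have hθle : dyadicBump (t₁ / 2 ^ i.1) * dyadicBump (t₂ / 2 ^ i.2) ≤ 1 :=
    mul_le_one₀ (dyadicBump_le_one _) (dyadicBump_nonneg _) (dyadicBump_le_one _)
  have hθnn : 0 ≤ dyadicBump (t₁ / 2 ^ i.1) * dyadicBump (t₂ / 2 ^ i.2) :=
    mul_nonneg (dyadicBump_nonneg _) (dyadicBump_nonneg _)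
  have hP := abs_prefactor_le (q := q) (c := c) hd₁ hd₂ (by positivity : (0 : ℝ) < 2 ^ i.1)
    (by positivity : (0 : ℝ) < 2 ^ i.2) h1 h2
  have hJ := abs_besselJ_one_le_one (4 * π * Real.sqrt (u * t₁ * (1 * t₂)) / ((q : ℝ) * c))
  rw [boxWeightU, norm_mul, Complex.norm_real, Complex.norm_real, Real.norm_of_nonneg hθnn, Real.norm_eq_abs,
    abs_mul]
  calc dyadicBump (t₁ / 2 ^ i.1) * dyadicBump (t₂ / 2 ^ i.2) *
        (|((d₁ : ℝ) * t₁ * ((d₂ : ℝ) * t₂)) ^ (-(1 / 2 : ℝ)) *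
            cutoffW ((d₁ : ℝ) * t₁ * ((d₂ : ℝ) * t₂) / qhat q ^ 2) * (c : ℝ)⁻¹| *
          |besselJ 1 (4 * π * Real.sqrt (u * t₁ * (1 * t₂)) / ((q : ℝ) * c))|)
      ≤ 1 * (((d₁ : ℝ) * d₂ * ((2 : ℝ) ^ i.1 * 2 ^ i.2) / 4) ^ (-(1 / 2 : ℝ)) *
          cutoffW ((d₁ : ℝ) * d₂ * ((2 : ℝ) ^ i.1 * 2 ^ i.2) / 4 / qhat q ^ 2) * (c : ℝ)⁻¹ * 1) :=
        mul_le_mul hθle (mul_le_mul hP hJ (abs_nonneg _) hS0) (by positivity) zero_le_one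
    _ = _ := by ring

/-- `|J₁(z) − J₁(z′)| ≤ |z − z′|` (mean value, `|J₁′| ≤ 1`). [cite: DLMF, 10.14.1 and 10.6.1 — derivation] -/
theorem abs_besselJ_one_sub_le (z z' : ℝ) : |besselJ 1 z - besselJ 1 z'| ≤ |z - z'| := by
  have h := Convex.norm_image_sub_le_of_norm_deriv_le (f := besselJ 1) (C := 1) (s := Set.univ)
    (fun x _ ↦ (differentiable_besselJ 1 x)) (fun x _ ↦ by
      rw [← iteratedDeriv_one, Real.norm_eq_abs]
      exact OffDiagPoissonTwisted.abs_iteratedDeriv_besselJ_le_one 1 1 x)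
    convex_univ (Set.mem_univ z') (Set.mem_univ z)
  simpa [Real.norm_eq_abs] using h

/-- `|√u − √u′| ≤ |u − u′|/(2√u₀)` for `u, u′ ≥ u₀ > 0`. [folklore] -/
theorem abs_sqrt_sub_sqrt_le_of_le {u₀ u u' : ℝ} (hu₀ : 0 < u₀) (hu : u₀ ≤ u) (hu' : u₀ ≤ u') :
    |Real.sqrt u - Real.sqrt u'| ≤ |u - u'| / (2 * Real.sqrt u₀) := by
  have hs₀ : 0 < Real.sqrt u₀ := Real.sqrt_pos.mpr hu₀
  have hsu : Real.sqrt u₀ ≤ Real.sqrt u := Real.sqrt_le_sqrt hu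
  have hsu' : Real.sqrt u₀ ≤ Real.sqrt u' := Real.sqrt_le_sqrt hu'
  have hsum : 2 * Real.sqrt u₀ ≤ Real.sqrt u + Real.sqrt u' := by linarith
  have hprod : (Real.sqrt u - Real.sqrt u') * (Real.sqrt u + Real.sqrt u') = u - u' := by
    have h1 : Real.sqrt u * Real.sqrt u = u := Real.mul_self_sqrt (le_trans hu₀.le hu)
    have h2 : Real.sqrt u' * Real.sqrt u' = u' := Real.mul_self_sqrt (le_trans hu₀.le hu')
    nlinarith
  rw [le_div_iff₀ (by positivity)]
  calc |Real.sqrt u - Real.sqrt u'| * (2 * Real.sqrt u₀)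
      ≤ |Real.sqrt u - Real.sqrt u'| * (Real.sqrt u + Real.sqrt u') :=
        mul_le_mul_of_nonneg_left hsum (abs_nonneg _)
    _ = |Real.sqrt u - Real.sqrt u'| * |Real.sqrt u + Real.sqrt u'| := by
        rw [abs_of_pos (by linarith : 0 < Real.sqrt u + Real.sqrt u')]
    _ = |u - u'| := by rw [← abs_mul, hprod]

/-- **Lipschitz bound in `u`**: for `u, u′ ≥ u₀ > 0` and all `t`,
`‖Φ_{i,u}(t) − Φ_{i,u′}(t)‖ ≤ (2π·S₁/(q·c·√u₀))·|u − u′|`, `S₁ = (d₁d₂)^{−1/2}·W(d₁d₂K₁K₂/(4q̂²))·c⁻¹`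
(`|J₁(z)−J₁(z′)| ≤ |z−z′|`, `z − z′ = 4π√(t₁t₂)(√u − √u′)/(qc)`, and the prefactor absorbs `√(t₁t₂)`). [folklore] -/
theorem norm_boxWeightU_sub_le [NeZero q] (hd₁ : 1 ≤ d₁) (hd₂ : 1 ≤ d₂) (hc : 1 ≤ c) (i : ℕ × ℕ)
    {u₀ u u' : ℝ} (hu₀ : 0 < u₀) (hu : u₀ ≤ u) (hu' : u₀ ≤ u') (t₁ t₂ : ℝ) :
    ‖boxWeightU q d₁ d₂ u c i t₁ t₂ - boxWeightU q d₁ d₂ u' c i t₁ t₂‖ ≤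
      2 * π * (((d₁ : ℝ) * d₂) ^ (-(1 / 2 : ℝ)) * cutoffW ((d₁ : ℝ) * d₂ * ((2 : ℝ) ^ i.1 * 2 ^ i.2) / 4 / qhat q ^ 2) *
        (c : ℝ)⁻¹) / ((q : ℝ) * c * Real.sqrt u₀) * |u - u'| := by
  have hq0 : (0 : ℝ) < q := by exact_mod_cast Nat.pos_of_ne_zero (NeZero.ne q)
  have hc0 : (0 : ℝ) < c := by exact_mod_cast hc
  have hs₀ : 0 < Real.sqrt u₀ := Real.sqrt_pos.mpr hu₀
  have hD0 : 0 < (d₁ : ℝ) * d₂ := by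
    have : (0 : ℝ) < d₁ := by exact_mod_cast hd₁
    have : (0 : ℝ) < d₂ := by exact_mod_cast hd₂
    positivity
  set S₁ : ℝ := ((d₁ : ℝ) * d₂) ^ (-(1 / 2 : ℝ)) *
    cutoffW ((d₁ : ℝ) * d₂ * ((2 : ℝ) ^ i.1 * 2 ^ i.2) / 4 / qhat q ^ 2) * (c : ℝ)⁻¹ with hS₁
  have hS₁0 : 0 ≤ S₁ := by
    have := cutoffW_nonneg ((d₁ : ℝ) * d₂ * ((2 : ℝ) ^ i.1 * 2 ^ i.2) / 4 / qhat q ^ 2)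
    have := Real.rpow_pos_of_pos hD0 (-(1 / 2 : ℝ))
    positivity
  have hRHS0 : 0 ≤ 2 * π * S₁ / ((q : ℝ) * c * Real.sqrt u₀) * |u - u'| := by positivity
  by_cases hθ : dyadicBump (t₁ / 2 ^ i.1) * dyadicBump (t₂ / 2 ^ i.2) = 0
  · simp only [boxWeightU, hθ, Complex.ofReal_zero, zero_mul, sub_zero, norm_zero]
    exact hRHS0
  obtain ⟨⟨h1, -⟩, ⟨h2, -⟩⟩ := mem_box_of_bump₂_ne_zero hθ
  have ht1 : 0 < t₁ := lt_trans (by positivity) h1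
  have ht2 : 0 < t₂ := lt_trans (by positivity) h2
  have hθle : dyadicBump (t₁ / 2 ^ i.1) * dyadicBump (t₂ / 2 ^ i.2) ≤ 1 :=
    mul_le_one₀ (dyadicBump_le_one _) (dyadicBump_nonneg _) (dyadicBump_le_one _)
  have hθnn : 0 ≤ dyadicBump (t₁ / 2 ^ i.1) * dyadicBump (t₂ / 2 ^ i.2) :=
    mul_nonneg (dyadicBump_nonneg _) (dyadicBump_nonneg _)
  -- abbreviations
  set P : ℝ := ((d₁ : ℝ) * t₁ * ((d₂ : ℝ) * t₂)) ^ (-(1 / 2 : ℝ)) *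
    cutoffW ((d₁ : ℝ) * t₁ * ((d₂ : ℝ) * t₂) / qhat q ^ 2) * (c : ℝ)⁻¹ with hP
  set z : ℝ := 4 * π * Real.sqrt (u * t₁ * (1 * t₂)) / ((q : ℝ) * c) with hz
  set z' : ℝ := 4 * π * Real.sqrt (u' * t₁ * (1 * t₂)) / ((q : ℝ) * c) with hz'
  have hPs : |P| * Real.sqrt (t₁ * t₂) ≤ S₁ :=
    abs_prefactor_mul_sqrt_le (q := q) (c := c) hd₁ hd₂ (by positivity : (0 : ℝ) < 2 ^ i.1)
      (by positivity : (0 : ℝ) < 2 ^ i.2) h1 h2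
  -- the difference of the Bessel arguments
  have hzz : |z - z'| = 4 * π * Real.sqrt (t₁ * t₂) * |Real.sqrt u - Real.sqrt u'| / ((q : ℝ) * c) := by
    have hu0 : 0 ≤ u := le_trans hu₀.le hu
    have hu0' : 0 ≤ u' := le_trans hu₀.le hu'
    have e1 : Real.sqrt (u * t₁ * (1 * t₂)) = Real.sqrt u * Real.sqrt (t₁ * t₂) := by
      rw [show u * t₁ * (1 * t₂) = u * (t₁ * t₂) by ring, Real.sqrt_mul hu0]
    have e2 : Real.sqrt (u' * t₁ * (1 * t₂)) = Real.sqrt u' * Real.sqrt (t₁ * t₂) := by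
      rw [show u' * t₁ * (1 * t₂) = u' * (t₁ * t₂) by ring, Real.sqrt_mul hu0']
    rw [hz, hz', e1, e2, ← sub_div, abs_div, abs_of_pos (by positivity : (0 : ℝ) < (q : ℝ) * c),
      show 4 * π * (Real.sqrt u * Real.sqrt (t₁ * t₂)) - 4 * π * (Real.sqrt u' * Real.sqrt (t₁ * t₂)) =
        4 * π * Real.sqrt (t₁ * t₂) * (Real.sqrt u - Real.sqrt u') by ring, abs_mul,
      abs_of_pos (by positivity : (0 : ℝ) < 4 * π * Real.sqrt (t₁ * t₂))]
  have hsq := abs_sqrt_sub_sqrt_le_of_le hu₀ hu hu'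
  -- the difference of the weights
  have hdiff : boxWeightU q d₁ d₂ u c i t₁ t₂ - boxWeightU q d₁ d₂ u' c i t₁ t₂ =
      ((dyadicBump (t₁ / 2 ^ i.1) * dyadicBump (t₂ / 2 ^ i.2) : ℝ) : ℂ) *
        ((P * (besselJ 1 z - besselJ 1 z') : ℝ) : ℂ) := by
    simp only [boxWeightU, hP, hz, hz']
    push_cast
    ring
  rw [hdiff, norm_mul, Complex.norm_real, Complex.norm_real, Real.norm_of_nonneg hθnn, Real.norm_eq_abs,
    abs_mul]
  calc dyadicBump (t₁ / 2 ^ i.1) * dyadicBump (t₂ / 2 ^ i.2) * (|P| * |besselJ 1 z - besselJ 1 z'|)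
      ≤ 1 * (|P| * |z - z'|) :=
        mul_le_mul hθle (mul_le_mul_of_nonneg_left (abs_besselJ_one_sub_le z z') (abs_nonneg _))
          (by positivity) zero_le_one
    _ = |P| * Real.sqrt (t₁ * t₂) * (4 * π * |Real.sqrt u - Real.sqrt u'| / ((q : ℝ) * c)) := by
        rw [one_mul, hzz]; ring
    _ ≤ S₁ * (4 * π * (|u - u'| / (2 * Real.sqrt u₀)) / ((q : ℝ) * c)) := by
        refine mul_le_mul hPs ?_ (by positivity) hS₁0
        exact div_le_div_of_nonneg_right (mul_le_mul_of_nonneg_left hsq (by positivity)) (by positivity)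
    _ = 2 * π * S₁ / ((q : ℝ) * c * Real.sqrt u₀) * |u - u'| := by
        field_simp
        ring

end Summit.Parity.GeneralizedHardyLittlewood.Theorems.BeyondDiagonalBeatsQuarter.OffDiag
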